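import Literature.NumberTheory.EllipticCurves.Wuthrich2014.SplitMultiplicativeDivisibility
import Literature.NumberTheory.EllipticCurves.PAdicLFunctionMultiplicativeInterpolation
import HarnessLib

/-!
# Wuthrich 2014, Corollary 19 — Kato's divisibility at an odd NON-SPLIT MULTIPLICATIVE prime of a semi-stable curve (named fact)

Topic `Literature/NumberTheory/EllipticCurves` (cluster `Wuthrich2014`). ONE named fact (nothing
asserted) and one bookkeeping projection; companion of `SplitMultiplicativeDivisibility.lean`
(p179618, the split clause), now that the one-Euler-factor interpolation package
`IsMultPAdicLFunctionOf` (p179713) is available. HONEST FRAMING (BSD rank-≤1 residual cell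
`b2b-bsdres`, unit `b2b-bsdres-x11a` gen 4): a PUBLISHED input of the per-curve `p`-adic
certificate lever at `p ‖ N` (`Rank1Residual/Typed/PAdicCertificateEngine.lean`, p179575) for
SEMI-STABLE curves at a NON-split multiplicative prime; not a class theorem; nothing here is
"finishing BSD".

C. Wuthrich, *On the integrality of modular symbols and Kato's Euler system for elliptic curves*,
Doc. Math. 19 (2014) 381–402, doi:10.4171/dm/450 (publisher PDF read 2026-08-19; the hub's older
rendering `paper:doi-10-4171-dm-450` is the author's 2013 version), Corollary 19 (journal p. 398),
as PUBLISHED: "If `E/ℚ` is a semi-stable elliptic curve and `p` an odd prime where `E` has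
ordinary reduction, then `char_Λ(X(E))`, or `I char_Λ(X(E))` in the split multiplicative case,
divides the ideal generated by `L_p(E)`." (The words "where `E` has ordinary reduction" were added
in the published revision; a multiplicative prime is ordinary in the paper's sense, p. 383. Proof
and notation quoted in the companion file: Serre's dichotomy, Thm. 16 in the Borel case, Kato's
theorem in the surjective case, §1 p. 383; `p = 3` via Lemma 20, p. 399; "the hypothesis … that
`E` is semi-stable can not be dropped", p. 399; `X(E)` the dual of the CLASSICAL Selmer group over
the cyclotomic `ℤ_p`-extension, §5 p. 397; `L_p(E) ∈ Λ`, Cor. 18 (p. 398, "semi-stable ordinary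
reduction at `p > 2`"), normalised by the Néron lattice.) At a NON-split multiplicative prime
(`a_p = -1`) there is no augmentation ideal and no exceptional zero: the clause reads
`char_Λ X(E) ∣ (L_p(E))` in `Λ`, with `L_p(E)` the Mazur–Tate–Teitelbaum function for `ε(p) = 0`,
allowable root `α = a_p = -1` — in the tree's vocabulary `IsMultPAdicLFunctionOf f p (-1) L`
(`Ω⁺_f`-normalised; `ϖ · Ω_E = Ω⁺_f` converts, exactly as in `charIdeal_dvd_padicLFunction`).

Use (REPORT-g4.md §H3): with `g ∈ char_Λ X` and `ι g = ϖ · L` this is the input `hι` (with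
`e = 0`, `c = ϖ`) of `Typed.padicValNat_card_shaPrimary_le_of_leadingTerm_shape`; on the lane
collector of 2026-08-18 it concerns the 18 semistable non-split rank-one `T-CAS` pairs (13 with
`p ∣ ∏ c_q`). The other class-level input (Jones 1989, the leading term at a multiplicative prime) is
not yet held (acq-07893).

References: [Wuthrich2014] Cor. 19 (p. 398), Thm. 16 and §5 (p. 397), Cor. 18 (p. 398);
[Kato2004Asterisque]
Thm. 17.4; [MazurTateTeitelbaum1986] §I.10, §I.14; [GreenbergLNM1716] §4 (PDF p. 113).
-/

set_option autoImplicit false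

noncomputable section

open scoped Classical MatrixGroups ModularForm

open CongruenceSubgroup WeierstrassCurve Literature.NumberTheory.EllipticCurves
  Literature.NumberTheory.EllipticCurves.ModularForms

namespace Literature.NumberTheory.EllipticCurves.Wuthrich2014

/-- **Wuthrich 2014, Corollary 19 (non-split multiplicative clause): for a semi-stable `E/ℚ` and an
odd prime `p` of NON-split multiplicative reduction, `char_Λ X(E)` divides `(L_p(E))` in `Λ`.** As
published (Doc. Math. 19 (2014), Cor. 19, p. 398): "If `E/ℚ` is a semi-stable elliptic curve and `p`
an odd prime where `E` has ordinary reduction, then `char_Λ(X(E))`, or `I char_Λ(X(E))` in the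
split multiplicative case, divides the ideal generated by `L_p(E)`." (A multiplicative prime is
ordinary in the paper's sense, p. 383.) Transcription of the NON-split multiplicative clause ONLY
(companion of `corollary19_splitMultiplicative`), same vocabulary: `W` a globally minimal model
of a semi-stable
`E/ℚ` (`W.IsSemistable ℤ`), `p ≠ 2` a prime of multiplicative, not split multiplicative, reduction
(`HasMultiplicativeReductionAtPrime ∧ ¬ HasSplitMultiplicativeReductionAtPrime`, i.e. `a_p = -1`),
`ℚ_∞/ℚ` the cyclotomic `ℤ_p`-extension `κ` with topological generator `γ` matching the cyclotomic
variable, `f` the newform of `E`, `D` a Pontryagin-dual datum of the (classical) Selmer group over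
`ℚ_∞` (`char_Λ X = D.charIdeal`), `ϖ ∈ ℚ` with `ϖ · Ω_E = Ω⁺_f`, and `L` the `Ω⁺_f`-normalised
`p`-adic `L`-function at the non-split prime (`IsMultPAdicLFunctionOf f p (-1) L`: MTT §I.10 with
`ε(p) = 0`, `α = a_p = -1`; constant term `2[0]⁺_f`, no exceptional zero). Conclusion:
`ϖ · L ∈ ι(char_Λ X)`, i.e. `ι g = ϖ · L` for some `g ∈ char_Λ X` (`ι = iwasawaToPowerSeries p`).
Nothing asserted (named fact).
-- TODO(general form): the good ordinary clause of Cor. 19 (surjective `ρ_{E,p}`) is Kato's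
-- Thm. 17.4 (3), tree `kato_divisibility`; Cor. 19 is stated for semi-stable `E` only ("can not be
-- dropped", p. 399).
[cite: Wuthrich2014, Cor. 19 (p. 398), Thm. 16 and §5 (p. 397), Cor. 18 (p. 398)] -/
def corollary19_nonsplitMultiplicative : Prop :=
  ∀ (W : WeierstrassCurve ℚ) [W.IsElliptic] [W.IsGloballyMinimal] (p : ℕ) [Fact p.Prime]
    {κ : ZpExtension ℚ p} {γ : Field.absoluteGaloisGroup ℚ} {N : ℕ} [NeZero N]
    {f : CuspForm (Gamma0 N) 2},
    p ≠ 2 → W.IsSemistable ℤ → W.HasMultiplicativeReductionAtPrime p →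
    ¬ W.HasSplitMultiplicativeReductionAtPrime p →
    κ.IsCyclotomic → κ.IsTopGenerator γ → IsCyclotomicVariable p γ → IsNewformOf W f →
    ∀ (D : W.SelmerDualData κ γ) (ϖ : ℚ), (ϖ : ℝ) * W.realPeriodRat = plusPeriod f →
    ∀ (L : PowerSeries ℚ_[p]), IsMultPAdicLFunctionOf f p (-1) L →
      ∃ g ∈ D.charIdeal, iwasawaToPowerSeries p g = PowerSeries.C ((ϖ : ℚ) : ℚ_[p]) * L

/-- **Bookkeeping: Cor. 19 (non-split clause) in the shape of the `p`-adic certificate engine**: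
the divisibility input `hι` of `Typed.padicValNat_card_shaPrimary_le_of_leadingTerm_shape` holds
with `e = 0` and `c = ϖ` (`ϖ · L = T⁰ · ι g`). [cite: Wuthrich2014, Cor. 19 (p. 398)] -/
theorem corollary19_nonsplitMultiplicative.exists_engine_shape
    (h19 : corollary19_nonsplitMultiplicative)
    (W : WeierstrassCurve ℚ) [W.IsElliptic] [W.IsGloballyMinimal] (p : ℕ) [Fact p.Prime]
    {κ : ZpExtension ℚ p} {γ : Field.absoluteGaloisGroup ℚ} {N : ℕ} [NeZero N]
    {f : CuspForm (Gamma0 N) 2} (hp : p ≠ 2) (hss : W.IsSemistable ℤ)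
    (hmult : W.HasMultiplicativeReductionAtPrime p)
    (hns : ¬ W.HasSplitMultiplicativeReductionAtPrime p) (hκ : κ.IsCyclotomic)
    (hγ : κ.IsTopGenerator γ) (hγ' : IsCyclotomicVariable p γ) (hf : IsNewformOf W f)
    (D : W.SelmerDualData κ γ) (ϖ : ℚ) (hϖ : (ϖ : ℝ) * W.realPeriodRat = plusPeriod f)
    (L : PowerSeries ℚ_[p]) (hL : IsMultPAdicLFunctionOf f p (-1) L) :
    ∃ g ∈ D.charIdeal, PowerSeries.C ((ϖ : ℚ) : ℚ_[p]) * L =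
      PowerSeries.X ^ 0 * iwasawaToPowerSeries p g := by
  obtain ⟨g, hg, hιg⟩ := h19 W p hp hss hmult hns hκ hγ hγ' hf D ϖ hϖ L hL
  exact ⟨g, hg, by rw [pow_zero, one_mul, hιg]⟩

end Literature.NumberTheory.EllipticCurves.Wuthrich2014

end
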